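import Summits.BirchSwinnertonDyer.Rank1Residual.X1.MuPart
import Summits.BirchSwinnertonDyer.Rank1Residual.X2.MuTransferDerived
import Summits.BirchSwinnertonDyer.Rank1Residual.X2.CongruentLambdaShiftMultiplicative
import Summits.BirchSwinnertonDyer.Rank1Residual.X2.CongruenceTransfer
import Literature.NumberTheory.EllipticCurves.Rank1Residual.ClassX1
import Literature.NumberTheory.EllipticCurves.GreenbergVatsal2000.CongruentCurves
import Literature.NumberTheory.EllipticCurves.KatoRankBoundProofs
import Literature.NumberTheory.EllipticCurves.IwasawaSelmerDualProofs
import Literature.NumberTheory.DiophantineGeometry.LocalReductionFiniteBadPlacesProofs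
import Literature.Barriers.BirchSwinnertonDyer.EisensteinMuConjecture
import HarnessLib

/-!
# Crux `MazurMCOnX1RankZero` (stmt-BirchSwinnertonDyer-19035), line `mudescent`, stub
# `stub_analyticMuZero_offLocus`: the CONGRUENCE ROAD's transfer hypothesis (T) SHARPENED — an
# `E[p]`-congruent partner with `μ′_an = 0` buys EXACTLY Greenberg's algebraic `μ = 0` at `W₀`
# (cell `bsd-eis`, seat `bsd-eis-mu-c` g2, PROGRAMME PART 1b seat (3); NEGATIVE-expected probe —
# closes NO stub; route-INDEPENDENT imports, no `Theses` cone)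

CONTEXT. `EisensteinPrimesMazurMCOnX1RankZeroCongruenceRoad.lean` (g0, p460893) typed the road to the
open stub `ClassX1 W₀ p → W₀.analyticRank = 0 → ¬ HasRamifiedOddLineAt W₀ p → AnalyticMuLE W₀ p 0` as
stub ⇐ (T) ∧ (S): (T) «`E[p] ≅ E′[p]` transports the Néron-normalised analytic `μ = 0`», UNPRINTED
(GV Thms. (1.4)/(3.10), EPW Thm. 1 are irreducible-only; GV (3.11)/(3.12) serve the admissible sign
`−ψ(−1)`, the odd branch on type A), and (S) one congruent partner with `μ′_an = 0` per target.

THE TREE ALREADY HOLDS (composed here, not re-proved): the ALGEBRAIC transfer of `μ = 0` along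
`E[p] ≅ E′[p]` WITHOUT irreducibility in every reduction-type direction (GV p. 27 «if `μ_{E₁} = 0`,
then `μ_{E₂} = 0`»; LNM 1716 p. 132) — `X2.MuTransferDerived.mu_eq_zero_of_torsionIso_of_facts`,
`X2.CongruentLambdaShiftMultiplicative.mu_eq_zero_goodOrd_of_mult` — modulo the printed inputs
GV p. 26 / (5)–(7) / Prop. (2.5) / p. 15, Tate uniformisation, Kato cotorsion; the Kato–Wuthrich
reading `μ_an = 0 ⇒ μ(X(E/ℚ_∞)) = 0` (`X1.MuPart.mu_eq_zero_of_analyticMuLE_zero`,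
`X2.isTorsion_and_mu_eq_zero_of_analyticMuLE_zero`); the sandwich `muPartAt_of_analyticMuLE_zero`.

WHAT THIS FILE PROVES (theorems only; no `def`, no named fact, no `sorry`):
* §1 (M) ∧ (G) ⇒ `μ_an = 0` — route-free twin of mu-b's p462224 §1 (that module lies in the import
  cone of the route file; standing build rule 2026-08-26).
* §2 THE PARTNER BUYS (G): `V` good ordinary (resp. multiplicative) at the odd `p`, `W₀[p] ≅ V[p]`,
  `μ_an(V) = 0` ⇒ `μ(X(W₀/ℚ_∞)) = 0` for every cyclotomic dual datum (Conj. 1.11 AT `W₀`).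
* §3 HENCE (T) ⟺ (T_M): given such a partner, `AnalyticMuLE W₀ p 0 ↔ MuPartAt W₀ p`; g0's (T) is,
  pair by pair, EQUIVALENT to «the μ-PART of Mazur's main conjecture at the target»
  (`transfer_iff_muPartTransfer`): the road moves Greenberg's conjecture, never the μ-part.
* (sequel `…CongruenceRoadMuPartStub.lean`, §4–§5: the registered stub ⟺ (S′) «partner supply» ∧
  (M′) «`MuPartAt` at every étale end» — against mu-b's `stub ⟺ (M′) ∧ (G′)` the road RELAXES (G′) to
  (S′) and leaves (M′) untouched —, and (M′) ⇐ the crux itself: the road is consistent and circular.)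

HONEST FRAMING: a PROBE; nothing here proves or refutes the stub; every theorem is conditional only
on PUBLISHED named facts already used by the tree's route-G files (`hW16`, `hWu`, `hmod`, `hGV`, `hA`,
`hB`, `hT`, `hT'`, `hAm`, `hBm`, `hF`). The director's «to a congruent curve with computed `μ′ = 0`»
is answered exactly: a computed `μ′_an = 0` certifies Greenberg's algebraic conjecture at `W₀` (§2)
and nothing more (§3). References: [GreenbergVatsal2000] Thm. (1.4), §2 Prop. (2.8), pp. 26–27;
[GreenbergLNM1716] Conj. 1.11, p. 132; [Wuthrich2014] Thm. 16; [BCDTJAMS2001] Thm. A; HOME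
`run/shared/lean/pub/bsd-eis/mu-c-MEMO-1.md` ADDENDUM 3.
-/

set_option autoImplicit false

-- `Summit.BirchSwinnertonDyer.BirchSwinnertonDyer.…`: the summit and its single sub-problem share a name (D-0017 layout).
set_option linter.dupNamespace false

noncomputable section

open scoped Classical MatrixGroups ModularForm

open CongruenceSubgroup WeierstrassCurve NumberField IsDedekindDomain
  Literature.NumberTheory.EllipticCurves Literature.NumberTheory.EllipticCurves.ModularForms
  Literature.NumberTheory.EllipticCurves.Rank1Residual
  Literature.NumberTheory.EllipticCurves.GreenbergVatsal2000
  Literature.Barriers.BirchSwinnertonDyer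
  Summit.BirchSwinnertonDyer.Rank1Residual
  Summit.BirchSwinnertonDyer.Rank1Residual.X1.CongruenceTransfer
  Summit.BirchSwinnertonDyer.Rank1Residual.X1.MuLambda
  Summit.BirchSwinnertonDyer.Rank1Residual.X1.MuPart
  Summit.BirchSwinnertonDyer.Rank1Residual.X1.MuStructure
  Summit.BirchSwinnertonDyer.BirchSwinnertonDyer.Theorems
  Summit.BirchSwinnertonDyer.BirchSwinnertonDyer.Theorems.Rank1ResidualX1Defs

namespace Summit.BirchSwinnertonDyer.BirchSwinnertonDyer.Theorems.EisensteinPrimesMazurMCOnX1RankZeroCongruenceRoadMuPart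

/-! ## §0 Bookkeeping: a finite set of bad places away from `p`; `E[p] ≅ E[p]` -/

/-- For two elliptic curves over `ℚ` and a prime `p` there is a finite set `Σ₀` of finite places, none
above `p`, outside which (and away from `p`) both curves have good reduction — the `Σ₀` of
Greenberg–Vatsal §2 (the union of the two finite sets of bad places, `finite_badPlaces_holds`, with
the place above `p` removed). [cite: GreenbergVatsal2000, §2 p. 26 («let Σ₀ denote any set of primes
containing all primes l ≠ p dividing N, but not including p»)] -/
theorem exists_finset_badPlaces_away (W₁ W₂ : WeierstrassCurve ℚ) [W₁.IsElliptic] [W₂.IsElliptic]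
    (p : ℕ) :
    ∃ S₀ : Finset (HeightOneSpectrum (𝓞 ℚ)),
      (∀ v ∈ S₀, ((p : ℕ) : 𝓞 ℚ) ∉ v.asIdeal) ∧
      (∀ v : HeightOneSpectrum (𝓞 ℚ), v ∉ S₀ → ((p : ℕ) : 𝓞 ℚ) ∉ v.asIdeal →
        W₁.HasGoodReductionAt v) ∧
      (∀ v : HeightOneSpectrum (𝓞 ℚ), v ∉ S₀ → ((p : ℕ) : 𝓞 ℚ) ∉ v.asIdeal →
        W₂.HasGoodReductionAt v) := by
  have h₁ : (W₁.badPlaces (𝓞 ℚ)).Finite := W₁.finite_badPlaces_holds (𝓞 ℚ)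
  have h₂ : (W₂.badPlaces (𝓞 ℚ)).Finite := W₂.finite_badPlaces_holds (𝓞 ℚ)
  refine ⟨(h₁.union h₂).toFinset.filter (fun v ↦ ((p : ℕ) : 𝓞 ℚ) ∉ v.asIdeal), ?_, ?_, ?_⟩
  · intro v hv
    exact (Finset.mem_filter.mp hv).2
  · intro v hv hpv
    by_contra hbad
    exact hv (Finset.mem_filter.mpr ⟨(h₁.union h₂).mem_toFinset.mpr (Or.inl hbad), hpv⟩)
  · intro v hv hpv
    by_contra hbad
    exact hv (Finset.mem_filter.mpr ⟨(h₁.union h₂).mem_toFinset.mpr (Or.inr hbad), hpv⟩)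

/-- `E[p] ≅ E[p]` (the identity): `TorsionIso` is reflexive — the stub's own certificate at `W₀` is the
trivial instance of a «congruent partner with `μ_an = 0`». [folklore] -/
theorem torsionIso_refl (W : WeierstrassCurve ℚ) (p : ℕ) : TorsionIso W W p :=
  ⟨AddEquiv.refl _, fun _ _ ↦ rfl⟩

variable {W₀ V : WeierstrassCurve ℚ} [W₀.IsElliptic] [W₀.IsGloballyMinimal] [V.IsElliptic]
  [V.IsGloballyMinimal] {p : ℕ} [hp : Fact p.Prime]

/-! ## §1 (M) ∧ (G) ⇒ `μ_an = 0` (route-free twin of mu-b's p462224 §1) -/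

/-- **From the μ-part of the main conjecture and `μ(X(E/ℚ_∞)) = 0` to `μ_an = 0`** at a good ordinary
Eisenstein pair `(E,p)`, `p ≠ 2`, granted Wuthrich 2014 Thm. 16 (`hW16`): `MuPartAt W p` and
`μ(D.X) = 0` for every cyclotomic dual datum give `AnalyticMuLE W p 0` (Thm. 16: `ϖ·L_p = ι(g·h)`,
`char X = (g)`; `μ(g) = μ(X) = 0`, (M) ⇒ `μ(g·h) = 0` ⇒ unit content ⇒ a coefficient of norm `1`).
Route-free twin of `EisensteinPrimesMazurMCOnX1RankZeroAnalyticMuDecomposition.analyticMuLE_zero_of_muPartAt_of_mu_eq_zero`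
(same proof). [cite: Wuthrich2014, Thm. 16 (p. 397)] [cite: GreenbergVatsal2000, p. 2 (1)–(2)] -/
theorem analyticMuLE_zero_of_muPartAt_of_forall_mu_eq_zero {W : WeierstrassCurve ℚ} [W.IsElliptic]
    [W.IsGloballyMinimal] (hW16 : Wuthrich2014.charIdeal_dvd_padicLFunction)
    (hp2 : p ≠ 2) (hgood : W.HasGoodReductionAtPrime p) (hord : ¬ (p : ℤ) ∣ W.frobeniusTrace p)
    (hred : ¬ W.HasIrreducibleModPGaloisRep p) (hM : MuPartAt W p)
    (hG : ∀ (κ : ZpExtension ℚ p) (γ : Field.absoluteGaloisGroup ℚ),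
      κ.IsCyclotomic → κ.IsTopGenerator γ → IsCyclotomicVariable p γ →
      ∀ D : W.SelmerDualData κ γ, D.mu = 0) :
    AnalyticMuLE W p 0 := by
  intro _ f hf ϖ hϖ
  have hpP : p.Prime := Fact.out
  obtain ⟨κ, hκ, γ, hγ, hγ'⟩ := exists_isCyclotomic_isTopGenerator_isCyclotomicVariable_holds p
  obtain ⟨D⟩ := W.nonempty_selmerDualData_holds κ γ hγ
  haveI : Module.Finite (IwasawaAlgebra p) D.X := D.module_finite_holds hγ
  obtain ⟨hD, g', hg'mem, hι'⟩ := hW16 W p hp2 ⟨hgood, hord⟩ hred hκ hγ hγ' hf D ϖ hϖ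
  obtain ⟨g, hg⟩ := (charIdeal_isPrincipal_holds p D.X).principal
  have hchar : D.charIdeal = Ideal.span {g} := hg
  have hdvd : g ∣ g' := by
    rw [hchar] at hg'mem
    exact Ideal.mem_span_singleton.mp hg'mem
  obtain ⟨h, rfl⟩ := hdvd
  have hgh : g * h ≠ 0 := mul_ne_zero_of_iota_eq hgood hord hf hϖ D hι'
  have hg0 : g ≠ 0 := fun h0 ↦ hgh (by rw [h0, zero_mul])
  have hμg : mu g = 0 := by
    have h0 := hG κ γ hκ hγ hγ' D
    rw [SelmerDualData.mu] at h0
    rw [mu_generator_eq_muInvariant D.X hD hg0 hchar, h0]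
  have hμgh : mu (g * h) = 0 := Nat.le_zero.mp (hμg ▸ hM κ γ hκ hγ hγ' f hf ϖ hϖ D g h hchar hι')
  have hndvd : ¬ PowerSeries.C (p : ℤ_[p]) ∣ g * h := by
    intro hdvd
    have h1 : 1 ≤ mu (g * h) := le_mu_of_C_pow_dvd hgh (by rw [pow_one]; exact hdvd)
    omega
  obtain ⟨n, hn⟩ := (hasUnitContent_iff_exists_norm_coeff_map_eq_one (g * h)).mp
    ((hasUnitContent_iff_not_C_dvd (g * h)).mpr hndvd)
  refine ⟨n, ?_⟩
  rw [← hι', hn, Nat.cast_zero, zero_add, zpow_neg, zpow_one]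
  exact inv_lt_one_of_one_lt₀ (by exact_mod_cast hpP.one_lt)

/-! ## §2 The partner's certificate buys Greenberg's `μ = 0` at `W₀` -/

/-- **A good-ordinary congruent partner with `μ′_an = 0` gives `μ(X(W₀/ℚ_∞)) = 0`.** `W₀` good ordinary
at the odd prime `p` with `W₀[p]` reducible, `V` good ordinary at `p`, `W₀[p] ≅ V[p]` as `Γ_ℚ`-modules
(`TorsionIso`), and `X1.MuPart.AnalyticMuLE V p 0` (a unit coefficient in `ϖ·L_p(V,T)`). Then for
every cyclotomic dual datum `D` of `W₀`: `D.mu = 0` — Kato–Wuthrich at `V`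
(`mu_eq_zero_of_analyticMuLE_zero`: `μ(V) = 0`), then the tree's algebraic transfer
(`X2.MuTransferDerived.mu_eq_zero_of_torsionIso_of_facts`, GV p. 27) from `V` to `W₀`. Inputs by name:
Wuthrich Thm. 16 (`hW16`), modularity (`hmod`), GV p. 26 / (7) / Prop. (2.5) (`hGV`, `hA`, `hB`).
[cite: GreenbergVatsal2000, Thm. (1.4), §2 Prop. (2.8) and pp. 26–27] [cite: Wuthrich2014, Thm. 16 (p. 397)]
[cite: GreenbergLNM1716, p. 132 and Conj. 1.11] -/
theorem forall_mu_eq_zero_of_torsionIso_goodOrd (hW16 : Wuthrich2014.charIdeal_dvd_padicLFunction)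
    (hmod : nonempty_modularParametrizationData) (hGV : imKummer_ge_greenbergCondition_at_p)
    (hA : lambda_nonPrimitive_eq_add_sum_delta) (hB : divisible_nonPrimitiveSelmerInfty_of_mu_eq_zero)
    (hp2 : p ≠ 2) (hgood₀ : W₀.HasGoodReductionAtPrime p) (hord₀ : ¬ (p : ℤ) ∣ W₀.frobeniusTrace p)
    (hred₀ : ¬ W₀.HasIrreducibleModPGaloisRep p)
    (hgoodV : V.HasGoodReductionAtPrime p) (hordV : ¬ (p : ℤ) ∣ V.frobeniusTrace p)
    (hiso : TorsionIso W₀ V p) (hV : AnalyticMuLE V p 0)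
    {κ : ZpExtension ℚ p} {γ : Field.absoluteGaloisGroup ℚ}
    (hκ : κ.IsCyclotomic) (hγ : κ.IsTopGenerator γ) (hγ' : IsCyclotomicVariable p γ)
    (D : W₀.SelmerDualData κ γ) : D.mu = 0 := by
  haveI : NeZero (W₀.conductorNorm ℤ) := ⟨(W₀.conductorNorm_pos_holds).ne'⟩
  haveI : NeZero (V.conductorNorm ℤ) := ⟨(V.conductorNorm_pos_holds).ne'⟩
  have hredV : ¬ V.HasIrreducibleModPGaloisRep p := by
    intro hirr
    obtain ⟨e, he⟩ := hiso.symm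
    exact hred₀ (hasIrreducibleModPGaloisRep_of_torsionIso e he hirr)
  obtain ⟨DV⟩ := V.nonempty_selmerDualData_holds κ γ hγ
  haveI : Module.Finite (IwasawaAlgebra p) D.X := D.module_finite_holds hγ
  haveI : Module.Finite (IwasawaAlgebra p) DV.X := DV.module_finite_holds hγ
  have hμV : DV.mu = 0 :=
    mu_eq_zero_of_analyticMuLE_zero hW16 hmod hp2 hgoodV hordV hredV hV hκ hγ hγ' DV
  have hXV : DV.IsTorsion :=
    (isTorsion_and_exists_factorisation hW16 hmod hp2 hgoodV hordV hredV hκ hγ hγ' DV).1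
  have hX₀ : D.IsTorsion :=
    (isTorsion_and_exists_factorisation hW16 hmod hp2 hgood₀ hord₀ hred₀ hκ hγ hγ' D).1
  obtain ⟨S₀, hS₀, hSV, hSW⟩ := exists_finset_badPlaces_away V W₀ p
  exact X2.MuTransferDerived.mu_eq_zero_of_torsionIso_of_facts V W₀ S₀ hGV hA hB hp2 hgoodV hordV
    hgood₀ hord₀ hκ hγ hS₀ hSV hSW hiso.symm DV D hXV hX₀ hμV

/-- **A multiplicative congruent partner with `μ′_an = 0` gives `μ(X(W₀/ℚ_∞)) = 0`** (the mixed
direction `p ‖ N_V`, `p ∤ N_{W₀}`; by the predecessor file a multiplicative partner of a `ClassX1` curve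
is a SPLIT X2b curve, row A10). `W₀` good ordinary at the odd `p` with `W₀[p]` reducible, `V`
multiplicative at `p`, `TorsionIso W₀ V p`, `X2.AnalyticMuLE V p 0` (the Mazur–Tate–Teitelbaum function
of `V`, trivial zero included). Inputs by name: Wuthrich Thm. 16 at `p ∤ N` (`hW16`) and at `p ‖ N`
(`hWu`), modularity, Tate uniformisation (`hT`, `hT'`), GV (5)–(7) at `p ‖ N` (`hAm`), GV Prop. (2.5)
(`hBm`), GV p. 15 (`hF`), GV p. 26 and (7) (`hGV`, `hA`); the transfer is the tree's
`X2.CongruentLambdaShiftMultiplicative.mu_eq_zero_goodOrd_of_mult`.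
[cite: GreenbergVatsal2000, Thm. (1.4), §2 Prop. (2.8) and pp. 26–27] [cite: Wuthrich2014, Thm. 16 (p. 397)] -/
theorem forall_mu_eq_zero_of_torsionIso_mult (hW16 : Wuthrich2014.charIdeal_dvd_padicLFunction)
    (hWu : Wuthrich2014.thm16_charIdeal_dvd_multiplicative_of_reducible)
    (hmod : nonempty_modularParametrizationData)
    (hT : Silverman1994_thmV53_corV54_tateUniformisation.{0})
    (hT' : Silverman1994_thmV53_tateUniformisation.{0})
    (hAm : lambda_nonPrimitive_eq_add_sum_delta_multiplicative)
    (hBm : datumSelmer_divisible_of_finite_torsionBy) (hF : datumStrictSelmer_lt_datumSelmer_of_split)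
    (hGV : imKummer_ge_greenbergCondition_at_p) (hA : lambda_nonPrimitive_eq_add_sum_delta)
    (hp2 : p ≠ 2) (hgood₀ : W₀.HasGoodReductionAtPrime p) (hord₀ : ¬ (p : ℤ) ∣ W₀.frobeniusTrace p)
    (hred₀ : ¬ W₀.HasIrreducibleModPGaloisRep p) (hmultV : V.HasMultiplicativeReductionAtPrime p)
    (hiso : TorsionIso W₀ V p) (hV : X2.AnalyticMuLE V p 0)
    {κ : ZpExtension ℚ p} {γ : Field.absoluteGaloisGroup ℚ}
    (hκ : κ.IsCyclotomic) (hγ : κ.IsTopGenerator γ) (hγ' : IsCyclotomicVariable p γ)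
    (D : W₀.SelmerDualData κ γ) : D.mu = 0 := by
  haveI : NeZero (W₀.conductorNorm ℤ) := ⟨(W₀.conductorNorm_pos_holds).ne'⟩
  have hredV : ¬ V.HasIrreducibleModPGaloisRep p := by
    intro hirr
    obtain ⟨e, he⟩ := hiso.symm
    exact hred₀ (hasIrreducibleModPGaloisRep_of_torsionIso e he hirr)
  obtain ⟨DV⟩ := V.nonempty_selmerDualData_holds κ γ hγ
  haveI : Module.Finite (IwasawaAlgebra p) D.X := D.module_finite_holds hγ
  haveI : Module.Finite (IwasawaAlgebra p) DV.X := DV.module_finite_holds hγ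
  obtain ⟨hXV, hμV⟩ := X2.isTorsion_and_mu_eq_zero_of_analyticMuLE_zero hWu hmod
    hp2 hmultV hredV hV hκ hγ hγ' DV
  have hX₀ : D.IsTorsion :=
    (isTorsion_and_exists_factorisation hW16 hmod hp2 hgood₀ hord₀ hred₀ hκ hγ hγ' D).1
  obtain ⟨S₀, hS₀, hSV, hSW⟩ := exists_finset_badPlaces_away V W₀ p
  exact X2.CongruentLambdaShiftMultiplicative.mu_eq_zero_goodOrd_of_mult V W₀ S₀ hT hT' hAm hBm hF hGV
    hA hp2 hmultV hgood₀ hord₀ hκ hγ hS₀ hSV hSW hiso.symm DV D hXV hX₀ hμV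

/-! ## §3 Hence, given a partner: `μ_an(W₀) = 0` ⟺ the μ-part of the main conjecture at `W₀` -/

/-- **Given a good-ordinary congruent partner with `μ′_an = 0`: `AnalyticMuLE W₀ p 0 ↔ MuPartAt W₀ p`.**
(⇒ is the tree's sandwich `muPartAt_of_analyticMuLE_zero` and needs no partner; ⇐ is §1 with (G)
supplied by §2.) So, at a target with a certified partner, the analytic stub IS the μ-part of Mazur's
main conjecture at the target — the partner has removed exactly Greenberg's conjecture.
[cite: GreenbergVatsal2000, p. 4 and p. 27] [cite: Wuthrich2014, Thm. 16 (p. 397)] -/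
theorem analyticMuLE_zero_iff_muPartAt_of_torsionIso_goodOrd
    (hW16 : Wuthrich2014.charIdeal_dvd_padicLFunction) (hmod : nonempty_modularParametrizationData)
    (hGV : imKummer_ge_greenbergCondition_at_p) (hA : lambda_nonPrimitive_eq_add_sum_delta)
    (hB : divisible_nonPrimitiveSelmerInfty_of_mu_eq_zero)
    (hp2 : p ≠ 2) (hgood₀ : W₀.HasGoodReductionAtPrime p) (hord₀ : ¬ (p : ℤ) ∣ W₀.frobeniusTrace p)
    (hred₀ : ¬ W₀.HasIrreducibleModPGaloisRep p)
    (hgoodV : V.HasGoodReductionAtPrime p) (hordV : ¬ (p : ℤ) ∣ V.frobeniusTrace p)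
    (hiso : TorsionIso W₀ V p) (hV : AnalyticMuLE V p 0) :
    AnalyticMuLE W₀ p 0 ↔ MuPartAt W₀ p :=
  ⟨fun h ↦ muPartAt_of_analyticMuLE_zero hW16 hp2 hgood₀ hord₀ hred₀ h,
    fun hM ↦ analyticMuLE_zero_of_muPartAt_of_forall_mu_eq_zero hW16 hp2 hgood₀ hord₀ hred₀ hM
      fun _ _ hκ hγ hγ' D ↦ forall_mu_eq_zero_of_torsionIso_goodOrd hW16 hmod hGV hA hB hp2 hgood₀
        hord₀ hred₀ hgoodV hordV hiso hV hκ hγ hγ' D⟩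

/-- **Given a multiplicative congruent partner with `μ′_an = 0`: `AnalyticMuLE W₀ p 0 ↔ MuPartAt W₀ p`.**
[cite: GreenbergVatsal2000, p. 4 and p. 27] [cite: Wuthrich2014, Thm. 16 (p. 397)] -/
theorem analyticMuLE_zero_iff_muPartAt_of_torsionIso_mult
    (hW16 : Wuthrich2014.charIdeal_dvd_padicLFunction)
    (hWu : Wuthrich2014.thm16_charIdeal_dvd_multiplicative_of_reducible)
    (hmod : nonempty_modularParametrizationData)
    (hT : Silverman1994_thmV53_corV54_tateUniformisation.{0})
    (hT' : Silverman1994_thmV53_tateUniformisation.{0})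
    (hAm : lambda_nonPrimitive_eq_add_sum_delta_multiplicative)
    (hBm : datumSelmer_divisible_of_finite_torsionBy) (hF : datumStrictSelmer_lt_datumSelmer_of_split)
    (hGV : imKummer_ge_greenbergCondition_at_p) (hA : lambda_nonPrimitive_eq_add_sum_delta)
    (hp2 : p ≠ 2) (hgood₀ : W₀.HasGoodReductionAtPrime p) (hord₀ : ¬ (p : ℤ) ∣ W₀.frobeniusTrace p)
    (hred₀ : ¬ W₀.HasIrreducibleModPGaloisRep p) (hmultV : V.HasMultiplicativeReductionAtPrime p)
    (hiso : TorsionIso W₀ V p) (hV : X2.AnalyticMuLE V p 0) :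
    AnalyticMuLE W₀ p 0 ↔ MuPartAt W₀ p :=
  ⟨fun h ↦ muPartAt_of_analyticMuLE_zero hW16 hp2 hgood₀ hord₀ hred₀ h,
    fun hM ↦ analyticMuLE_zero_of_muPartAt_of_forall_mu_eq_zero hW16 hp2 hgood₀ hord₀ hred₀ hM
      fun _ _ hκ hγ hγ' D ↦ forall_mu_eq_zero_of_torsionIso_mult hW16 hWu hmod hT hT' hAm hBm hF hGV hA
        hp2 hgood₀ hord₀ hred₀ hmultV hiso hV hκ hγ hγ' D⟩

/-- **(T) ⟺ (T_M), pair by pair.** For a good-ordinary reducible target `W₀` and a good-ordinary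
partner `V` with `W₀[p] ≅ V[p]`: the road's transfer «`μ_an(V) = 0 ⇒ μ_an(W₀) = 0`» (hypothesis (T) of
`EisensteinPrimesMazurMCOnX1RankZeroCongruenceRoad.stub_analyticMuZero_offLocus_of_congruenceRoad`,
instantiated at the pair) holds IF AND ONLY IF «`μ_an(V) = 0` ⇒ the μ-part of Mazur's main
conjecture at `W₀`». The unprinted content of (T) is therefore exactly `MuPartAt` at the target: no
congruence argument that does not prove the μ-part of the main conjecture can supply it.
[cite: GreenbergVatsal2000, Thm. (1.4) and p. 27] -/
theorem transfer_iff_muPartTransfer (hW16 : Wuthrich2014.charIdeal_dvd_padicLFunction)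
    (hmod : nonempty_modularParametrizationData) (hGV : imKummer_ge_greenbergCondition_at_p)
    (hA : lambda_nonPrimitive_eq_add_sum_delta) (hB : divisible_nonPrimitiveSelmerInfty_of_mu_eq_zero)
    (hp2 : p ≠ 2) (hgood₀ : W₀.HasGoodReductionAtPrime p) (hord₀ : ¬ (p : ℤ) ∣ W₀.frobeniusTrace p)
    (hred₀ : ¬ W₀.HasIrreducibleModPGaloisRep p)
    (hgoodV : V.HasGoodReductionAtPrime p) (hordV : ¬ (p : ℤ) ∣ V.frobeniusTrace p)
    (hiso : TorsionIso W₀ V p) :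
    (AnalyticMuLE V p 0 → AnalyticMuLE W₀ p 0) ↔ (AnalyticMuLE V p 0 → MuPartAt W₀ p) :=
  imp_congr_right fun hV ↦ analyticMuLE_zero_iff_muPartAt_of_torsionIso_goodOrd hW16 hmod hGV hA hB
    hp2 hgood₀ hord₀ hred₀ hgoodV hordV hiso hV

end Summit.BirchSwinnertonDyer.BirchSwinnertonDyer.Theorems.EisensteinPrimesMazurMCOnX1RankZeroCongruenceRoadMuPart

end
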